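import Mathlib
import Literature.AlgebraicGeometry.Resolution.KummerConeFaces
import Summits.ResolutionOfSingularities.ResolutionOfSingularities.Theorems.PAlterationPicoverLocalModelLocalChartsWound

/-!
# Crux `PicoverLocalModel` (stmt-ResolutionOfSingularities-0557), line `SketchIdeator3`
# (giraud-cossart-normal-form) — endgame, local charts: the two global charts at a
# wound / transversal point

Helper of the stub `stub_localCharts`. The global charts of the normalised `p`-cyclic cover
near a centre `w ∈ W` are: at a Kummer centre the Kummer chart `P = kummerCone p j₀ c → B`,
`ψ(v)^p = x^{e(v)}` (`e = kummerExp v`); at a wound/transversal centre the orthant chart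
`ℕʳ → B`, `v ↦ x^v`. At a point `w'` near `w` with `O = 𝒪_{W,w'}`, let `J = {j | x_j ∈ 𝔪}`
(enumerated by `σ`) and suppose the radicand is in wound/transversal form for the sub-family
`x ∘ σ` (for the Kummer chart this is the case `p ∣ A_j` for all `j ∈ J`). This file feeds both
charts into `isLogRegularLocal_of_woundForm`: the chart values are monomials in `x ∘ σ` up to
units and `p`-th powers, the exponent map hits the unit vectors, and the face of units has
rank `r - #J` (`finrank_span_face_kummerCone`, `finrank_span_face_nonneg`):

* `isLogRegularLocal_kummerChart_of_dvd` — Kummer chart, all `A_j`, `j ∈ J`, divisible by `p`;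
* `isLogRegularLocal_orthantChart` — orthant chart.
-/

noncomputable section

-- single-problem summit: the doubled namespace component `ResolutionOfSingularities` is the tree layout
set_option linter.dupNamespace false

open IsLocalRing Polynomial Literature.AlgebraicGeometry.Resolution

namespace Summit.ResolutionOfSingularities.ResolutionOfSingularities.Theorems.PicoverLocalModel.LocalCharts

universe u

/-- Splitting a product over all coordinates into the part off `J` and the part on `J`,
enumerated by `σ`. [folklore] -/
theorem prod_eq_prod_compl_mul_prod_enum {O : Type*} [CommMonoid O] {r s : ℕ}
    (J : Finset (Fin r)) (σ : Fin s → Fin r) (hσ : Function.Injective σ)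
    (hJ : ∀ j, j ∈ J ↔ ∃ i, σ i = j) (f : Fin r → O) :
    ∏ j, f j = (∏ j ∈ Jᶜ, f j) * ∏ i, f (σ i) := by
  classical
  rw [← Finset.prod_compl_mul_prod J]
  congr 1
  have hJ' : J = Finset.univ.image σ := by
    ext j; simp [hJ]
  rw [hJ', Finset.prod_image fun i _ i' _ h => hσ h]

/-- The cardinality of `J` is the length of an injective enumeration. [folklore] -/
theorem card_eq_of_enum {r s : ℕ} (J : Finset (Fin r)) (σ : Fin s → Fin r)
    (hσ : Function.Injective σ) (hJ : ∀ j, j ∈ J ↔ ∃ i, σ i = j) : J.card = s := by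
  classical
  have hJ' : J = Finset.univ.image σ := by
    ext j; simp [hJ]
  rw [hJ', Finset.card_image_of_injective _ hσ, Finset.card_univ, Fintype.card_fin]

/-- The boundary ideals `(∏_j x_j)` and `(∏_i x_{σ i})` of `N` agree when the `x_j`, `j ∉ J`,
are units. [folklore] -/
theorem span_prod_eq_span_prod_enum {O N : Type*} [CommRing O] [CommRing N] [IsDomain N]
    [Algebra O N] {r s : ℕ} (x : Fin r → O) (J : Finset (Fin r)) (σ : Fin s → Fin r)
    (hσ : Function.Injective σ) (hJ : ∀ j, j ∈ J ↔ ∃ i, σ i = j)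
    (hxu : ∀ j, j ∉ J → IsUnit (x j)) :
    Ideal.span {algebraMap O N (∏ j, x j)} = Ideal.span {algebraMap O N (∏ i, x (σ i))} := by
  apply Ideal.span_singleton_eq_span_singleton.mpr
  rw [prod_eq_prod_compl_mul_prod_enum J σ hσ hJ x, map_mul]
  refine associated_unit_mul_left _ _ (IsUnit.map _ ?_)
  exact IsUnit.prod_iff.mpr fun j hj => hxu j (Finset.mem_compl.mp hj)

/-- **The Kummer chart at a point where all boundary exponents are divisible by `p`.** See
the module docstring. [cite: Kato1994, Def. (2.1) and Thm. 11.6] -/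
theorem isLogRegularLocal_kummerChart_of_dvd : ∀ {O N : Type u} [CommRing O] [IsRegularLocalRing O] (p : ℕ) [Fact p.Prime] [CharP O p] [CommRing N] [IsDomain N] [IsIntegrallyClosed N] [Algebra O N] [Algebra.IsIntegral O N] {r : ℕ} (x : Fin r → O) (A : Fin r → ℕ) (j₀ : Fin r) (c₀ : ℕ), c₀ * A j₀ % p = 1 → ∀ {s : ℕ} (σ : Fin s → Fin r), Function.Injective σ → (∀ j, x j ∈ IsLocalRing.maximalIdeal O ↔ ∃ i, σ i = j) → (∀ α : Fin s → O, ∑ i, α i * x (σ i) ∈ IsLocalRing.maximalIdeal O ^ 2 → ∀ i, α i ∈ IsLocalRing.maximalIdeal O) → (∀ i, p ∣ A (σ i)) → ∀ (a g u : O) (B : Fin s → ℕ), IsWoundOrTransversalAt p (fun i => x (σ i)) u → a = g ^ p + (∏ i, x (σ i) ^ B i) ^ p * u → ∀ [IsDomain (AdjoinRoot ((Polynomial.X : Polynomial O) ^ p - Polynomial.C a))] (t : N), t ^ p = algebraMap O N a → Function.Injective (algebraMap O N) → (∀ z : N, ∃ d : O, d ≠ 0 ∧ ∃ q : Polynomial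 O, algebraMap O N d * z = Polynomial.aeval t q) → ∀ (ψ : Multiplicative (kummerCone p j₀ (fun j => c₀ * A j % p)) →* N), (∀ v : kummerCone p j₀ (fun j => c₀ * A j % p), ψ (Multiplicative.ofAdd v) ^ p = algebraMap O N (∏ j, x j ^ (kummerExp p j₀ (fun j => c₀ * A j % p) v j).toNat)) → IsRegularLocalRing N ∧ LogChart.IsLogRegularLocal (kummerCone p j₀ (fun j => c₀ * A j % p)) ψ ∧ divisorialMonoid (Ideal.span {algebraMap O N (∏ j, x j)}) = IsUnit.submonoid N ⊔ MonoidHom.mrange ψ := by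
  intro O N _ _ p _ _ _ _ _ _ _ r x A j₀ c₀ hc₀ s σ hσ hJσ hli hdvd a g u B hu ha _ t ht hinj hbir ψ hψ
  classical
  have hp : p.Prime := Fact.out
  haveI := isDomain_of_isRegularLocalRing O
  set J : Finset (Fin r) := Finset.univ.filter fun j => x j ∈ maximalIdeal O with hJdef
  have hJ : ∀ j, j ∈ J ↔ ∃ i, σ i = j := fun j => by simp [hJdef, hJσ]
  have hσmem : ∀ i, x (σ i) ∈ maximalIdeal O := fun i => (hJσ _).mpr ⟨i, rfl⟩
  have hxu : ∀ j, j ∉ J → IsUnit (x j) := fun j hj =>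
    IsLocalRing.notMem_maximalIdeal.mp (fun h => hj ((hJ j).mpr ((hJσ j).mp h)))
  -- `j₀ ∉ J` since `p ∤ A_{j₀}`
  have hA₀ : ¬ p ∣ A j₀ := fun h => by
    have h1 := Nat.mod_eq_zero_of_dvd (dvd_mul_of_dvd_right h c₀)
    rw [hc₀] at h1
    exact one_ne_zero h1
  have hσne : ∀ i, σ i ≠ j₀ := fun i h => hA₀ (h ▸ hdvd i)
  -- the honest exponents on `J` are divisible by `p`
  have hdvdE : ∀ (v : kummerCone p j₀ (fun j => c₀ * A j % p)) (i : Fin s), p ∣ (kummerExp p j₀ (fun j => c₀ * A j % p) v (σ i)).toNat := by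
    intro v i
    have h0 : 0 ≤ kummerExp p j₀ (fun j => c₀ * A j % p) v (σ i) := v.2 (σ i)
    have hz : ((kummerExp p j₀ (fun j => c₀ * A j % p) v (σ i) : ℤ) : ZMod p) = 0 := by
      rw [kummerExp_residue j₀ A c₀ hc₀ (v : Fin r → ℤ) (σ i)]
      obtain ⟨k, hk⟩ := hdvd i
      rw [hk]
      push_cast
      rw [ZMod.natCast_self]
      ring
    rw [ZMod.intCast_zmod_eq_zero_iff_dvd, ← Int.toNat_of_nonneg h0] at hz
    exact Int.natCast_dvd_natCast.mp hz
  -- the exponent map of the chart on the coordinates `J`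
  let m : kummerCone p j₀ (fun j => c₀ * A j % p) →+ (Fin s → ℕ) :=
    { toFun := fun v i => (kummerExp p j₀ (fun j => c₀ * A j % p) v (σ i)).toNat / p
      map_zero' := by ext i; simp
      map_add' := fun v w => by
        ext i
        simp only [Pi.add_apply, AddSubmonoid.coe_add, map_add]
        rw [Int.toNat_add (v.2 _) (w.2 _), Nat.add_div_of_dvd_right (hdvdE v i)] }
  have hm_apply : ∀ v i, m v i = (kummerExp p j₀ (fun j => c₀ * A j % p) v (σ i)).toNat / p := fun v i => rfl
  have hpm : ∀ v i, p * m v i = (kummerExp p j₀ (fun j => c₀ * A j % p) v (σ i)).toNat := fun v i =>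
    Nat.mul_div_cancel' (hdvdE v i)
  -- the hypotheses of `isLogRegularLocal_of_woundForm`
  have hψ' : ∀ v : kummerCone p j₀ (fun j => c₀ * A j % p), ∃ η : O, IsUnit η ∧
      ψ (Multiplicative.ofAdd v) ^ p = algebraMap O N (η * ∏ i, x (σ i) ^ (p * m v i)) := by
    intro v
    refine ⟨∏ j ∈ Jᶜ, x j ^ (kummerExp p j₀ (fun j => c₀ * A j % p) v j).toNat,
      IsUnit.prod_iff.mpr fun j hj => (hxu j (Finset.mem_compl.mp hj)).pow _, ?_⟩
    rw [hψ v, prod_eq_prod_compl_mul_prod_enum J σ hσ hJ]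
    congr 2
    exact Finset.prod_congr rfl fun i _ => by rw [hpm]
  have hm : ∀ i, ∃ v : kummerCone p j₀ (fun j => c₀ * A j % p), m v = Pi.single i 1 := by
    intro i
    have hmem : (Pi.single (σ i) 1 : Fin r → ℤ) ∈ kummerCone p j₀ (fun j => c₀ * A j % p) := by
      have := single_mem_kummerCone p j₀ (fun j => c₀ * A j % p) (σ i) 1
      simpa using this
    refine ⟨⟨Pi.single (σ i) 1, hmem⟩, ?_⟩
    ext i'
    rw [hm_apply]
    change (kummerExp p j₀ (fun j => c₀ * A j % p) (Pi.single (σ i) 1) (σ i')).toNat / p = _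
    rw [kummerExp_single_of_ne p (fun j => c₀ * A j % p) (hσne i), mul_one, Pi.single_apply, Pi.single_apply]
    by_cases h : i' = i
    · subst h
      simp [hp.pos]
    · have : σ i' ≠ σ i := fun h' => h (hσ h')
      simp [this, h]
  have hface : {v : kummerCone p j₀ (fun j => c₀ * A j % p) | m v = 0} =
      {v : kummerCone p j₀ (fun j => c₀ * A j % p) |
        ∀ j ∈ J, kummerExp p j₀ (fun j => c₀ * A j % p) (v : Fin r → ℤ) j = 0} := by
    ext v
    simp only [Set.mem_setOf_eq]
    constructor
    · intro h j hj
      obtain ⟨i, rfl⟩ := (hJ j).mp hj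
      have h1 : m v i = 0 := by rw [h]; rfl
      have h2 := hpm v i
      rw [h1, mul_zero] at h2
      have h0 := v.2 (σ i)
      omega
    · intro h
      ext i
      rw [hm_apply, h (σ i) ((hJ _).mpr ⟨i, rfl⟩)]
      simp
  have hrank : Module.finrank ℤ (Submodule.span ℤ
      ((fun v : kummerCone p j₀ (fun j => c₀ * A j % p) => (v : Fin r → ℤ)) '' {v | m v = 0})) + s = r := by
    rw [hface, ← card_eq_of_enum J σ hσ hJ]
    exact finrank_span_face_kummerCone hp.pos j₀ (fun j => c₀ * A j % p) J
  obtain ⟨hreg, hlog, hdiv⟩ := isLogRegularLocal_of_woundForm p (fun i => x (σ i)) hσmem hli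
    a g u B hu ha t ht hinj hbir (kummerCone p j₀ (fun j => c₀ * A j % p)) ψ m hψ' hm hrank
  refine ⟨hreg, hlog, ?_⟩
  rw [span_prod_eq_span_prod_enum x J σ hσ hJ hxu]
  exact hdiv

/-- **The orthant chart at any point.** See the module docstring.
[cite: Kato1994, Def. (2.1) and Thm. 11.6] -/
theorem isLogRegularLocal_orthantChart : ∀ {O N : Type u} [CommRing O] [IsRegularLocalRing O] (p : ℕ) [Fact p.Prime] [CharP O p] [CommRing N] [IsDomain N] [IsIntegrallyClosed N] [Algebra O N] [Algebra.IsIntegral O N] {r : ℕ} (x : Fin r → O) {s : ℕ} (σ : Fin s → Fin r), Function.Injective σ → (∀ j, x j ∈ IsLocalRing.maximalIdeal O ↔ ∃ i, σ i = j) → (∀ α : Fin s → O, ∑ i, α i * x (σ i) ∈ IsLocalRing.maximalIdeal O ^ 2 → ∀ i, α i ∈ IsLocalRing.maximalIdeal O) → ∀ (a g u : O) (B : Fin s → ℕ), IsWoundOrTransversalAt p (fun i => x (σ i)) u → a = g ^ p + (∏ i, x (σ i) ^ B i) ^ p * u → ∀ [IsDomain (AdjoinRoot ((Polynomial.X : Polynomial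 O) ^ p - Polynomial.C a))] (t : N), t ^ p = algebraMap O N a → Function.Injective (algebraMap O N) → (∀ z : N, ∃ d : O, d ≠ 0 ∧ ∃ q : Polynomial O, algebraMap O N d * z = Polynomial.aeval t q) → ∀ (ψ : Multiplicative (AddSubmonoid.nonneg (Fin r → ℤ)) →* N), (∀ v : AddSubmonoid.nonneg (Fin r → ℤ), ψ (Multiplicative.ofAdd v) = algebraMap O N (∏ j, x j ^ ((v : Fin r → ℤ) j).toNat)) → IsRegularLocalRing N ∧ LogChart.IsLogRegularLocal (AddSubmonoid.nonneg (Fin r → ℤ)) ψ ∧ divisorialMonoid (Ideal.span {algebraMap O N (∏ j, x j)}) = IsUnit.submonoid N ⊔ MonoidHom.mrange ψ := by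
  intro O N _ _ p _ _ _ _ _ _ _ r x s σ hσ hJσ hli a g u B hu ha _ t ht hinj hbir ψ hψ
  classical
  have hp : p.Prime := Fact.out
  haveI := isDomain_of_isRegularLocalRing O
  set J : Finset (Fin r) := Finset.univ.filter fun j => x j ∈ maximalIdeal O with hJdef
  have hJ : ∀ j, j ∈ J ↔ ∃ i, σ i = j := fun j => by simp [hJdef, hJσ]
  have hσmem : ∀ i, x (σ i) ∈ maximalIdeal O := fun i => (hJσ _).mpr ⟨i, rfl⟩
  have hxu : ∀ j, j ∉ J → IsUnit (x j) := fun j hj =>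
    IsLocalRing.notMem_maximalIdeal.mp (fun h => hj ((hJ j).mpr ((hJσ j).mp h)))
  -- the exponent map
  let m : AddSubmonoid.nonneg (Fin r → ℤ) →+ (Fin s → ℕ) :=
    { toFun := fun v i => ((v : Fin r → ℤ) (σ i)).toNat
      map_zero' := by ext i; simp
      map_add' := fun v w => by
        ext i
        simp only [Pi.add_apply, AddSubmonoid.coe_add]
        exact Int.toNat_add (v.2 _) (w.2 _) }
  have hm_apply : ∀ v i, m v i = ((v : Fin r → ℤ) (σ i)).toNat := fun v i => rfl
  have hψ' : ∀ v : AddSubmonoid.nonneg (Fin r → ℤ), ∃ η : O, IsUnit η ∧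
      ψ (Multiplicative.ofAdd v) ^ p = algebraMap O N (η * ∏ i, x (σ i) ^ (p * m v i)) := by
    intro v
    refine ⟨∏ j ∈ Jᶜ, (x j ^ ((v : Fin r → ℤ) j).toNat) ^ p,
      IsUnit.prod_iff.mpr fun j hj => ((hxu j (Finset.mem_compl.mp hj)).pow _).pow _, ?_⟩
    rw [hψ v, ← map_pow, ← Finset.prod_pow,
      prod_eq_prod_compl_mul_prod_enum J σ hσ hJ (fun j => (x j ^ ((v : Fin r → ℤ) j).toNat) ^ p)]
    congr 2
    exact Finset.prod_congr rfl fun i _ => by rw [hm_apply, ← pow_mul, mul_comm]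
  have hm : ∀ i, ∃ v : AddSubmonoid.nonneg (Fin r → ℤ), m v = Pi.single i 1 := by
    intro i
    have hmem : (Pi.single (σ i) 1 : Fin r → ℤ) ∈ AddSubmonoid.nonneg (Fin r → ℤ) := by
      intro j
      by_cases h : j = σ i
      · subst h; simp
      · simp [h]
    refine ⟨⟨Pi.single (σ i) 1, hmem⟩, ?_⟩
    ext i'
    rw [hm_apply]
    change ((Pi.single (σ i) (1 : ℤ) : Fin r → ℤ) (σ i')).toNat = _
    rw [Pi.single_apply, Pi.single_apply]
    by_cases h : i' = i
    · subst h; simp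
    · have : σ i' ≠ σ i := fun h' => h (hσ h')
      simp [this, h]
  have hface : {v : AddSubmonoid.nonneg (Fin r → ℤ) | m v = 0} =
      {v : AddSubmonoid.nonneg (Fin r → ℤ) | ∀ j ∈ J, (v : Fin r → ℤ) j = 0} := by
    ext v
    simp only [Set.mem_setOf_eq]
    constructor
    · intro h j hj
      obtain ⟨i, rfl⟩ := (hJ j).mp hj
      have h1 : m v i = 0 := by rw [h]; rfl
      rw [hm_apply] at h1
      have h0 := v.2 (σ i)
      change (0 : ℤ) ≤ _ at h0
      omega
    · intro h
      ext i
      rw [hm_apply, h (σ i) ((hJ _).mpr ⟨i, rfl⟩)]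
      simp
  have hrank : Module.finrank ℤ (Submodule.span ℤ
      ((fun v : AddSubmonoid.nonneg (Fin r → ℤ) => (v : Fin r → ℤ)) '' {v | m v = 0})) + s = r := by
    rw [hface, ← card_eq_of_enum J σ hσ hJ]
    exact finrank_span_face_nonneg J
  obtain ⟨hreg, hlog, hdiv⟩ := isLogRegularLocal_of_woundForm p (fun i => x (σ i)) hσmem hli
    a g u B hu ha t ht hinj hbir (AddSubmonoid.nonneg (Fin r → ℤ)) ψ m hψ' hm hrank
  refine ⟨hreg, hlog, ?_⟩
  rw [span_prod_eq_span_prod_enum x J σ hσ hJ hxu]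
  exact hdiv

end Summit.ResolutionOfSingularities.ResolutionOfSingularities.Theorems.PicoverLocalModel.LocalCharts

end
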